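import Summits.HubbardSuperconductivity.HubbardSuperconductivity.Theorems.AnisotropyChordTransferFibre3WindowRate

/-!
# Route `AnisotropyChord` / H0 rotor rung: the λ-PART of the torus kernel obeys an exact sourced harmonic recursion — `ℓ(1,0) = λG̃_λ(0)/4` and `Σ_e ℓ(r+e) = (4−λ)ℓ(r) + λ(G̃_λ(0) − a₀(r))`

The near-pair HOLE₂ tail treats the λ-part `ℓ_L(r) := a_L(r;λ) − a_L(r;0)` (`λ = 3ε₁/2`; walk units `2ℓ`) as ERROR through the shell
majorant `2ρ(11.71 ln L + 5.9)/L²`; measured on the window it is `[(3π/8)ρ ln L + c(r)]/L²` with `c(r)/ρ ≤ 3` — the majorant is `8–11×`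
too large and is ≈ 75 % of the certificate's error (memo CAPACITY-DIAG-LEAN-g25 §3, §7).  Modelling `ℓ` instead of bounding it is the
main lever; this file records the EXACT structure that reduces the window's λ-part to the DIAGONAL λ-part and the capacity `G̃_λ(0)`
(both λ-versions of this generation's diagonal/capacity files), mirroring `…Fibre3WindowRate`:
* ★ `lamPart_axis`: `ℓ(eₓ) = λ·G̃_λ(0)/4` EXACTLY (`kernelAxisValue_holds` at `λ` and at `0`) — so `c(1,0) = (3π²/4)·lim(G̃_{λ_H}(0) − ln L/2π)`,
  the capacity constant;
* ★ `lamPart_nbSum`: `Σ_e ℓ(r+e) = (4 − λ)ℓ(r) + λ(G̃_λ(0) − a₀(r))` for EVERY `r` (`kernelHarmonicity_holds` at `λ` minus at `0`; the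
  `δ_{r0} − 1/V` sources cancel); integer-coordinate form `lamPart_identity`, solved forms `lamPart_next` (row step) and
  `lamPart_diag_next` (`2ℓ(n+1,n) = (4−λ)ℓ(n,n) + λ(G̃_λ(0) − a₀(n,n)) − 2ℓ(n,n−1)`, swap symmetry), symmetries `lamPart_swap`,
  `lamPart_mirror_y`; the first consequences `lamPart_two_zero`, `lamPart_two_one` (the window through `(2,1)` from `ℓ(1,1)`, `G̃_λ(0)`,
  `a₀(1,0) = (1 − 1/V)/4`, `a₀(1,1)`).
So W1 of the memo = two-sided asymptotics of `ℓ(n,n)` (diagonal formula at `λ > 0`) + of `G̃_λ(0)` (capacity constant) + this propagation.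
Prover seat `hubbard-h0-rotor-p1` g25; helper for stmt-HubbardSuperconductivity-19089 (`--supports`).
WHAT THIS IS NOT: nothing here proves superconductivity in the Hubbard model (rotor TARGET as worded stays FALSE, g15); exact
finite identities for ONE input (the λ-part of the kernel) of ONE input (HOLE₂) of ONE conditional reduction (rung 19089).
Mathlib + tree imports only; no sorry, no axioms.
-/

set_option linter.dupNamespace false
set_option autoImplicit false

noncomputable section

open scoped BigOperators
open Complex

namespace Summit.HubbardSuperconductivity.HubbardSuperconductivity.Theorems.AnisotropyChord.Transfer.Fibre3

namespace Subsample

variable (L : ℕ) [NeZero L]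

/-! ## The axis value and the sourced recursion of the λ-part -/

/-- ★ `ℓ(eₓ) = a_λ(1,0) − a₀(1,0) = λ·G̃_λ(0)/4` exactly (`0 ≤ λ < 2ε₁`). [folklore] -/
theorem lamPart_axis {lam : ℝ} (h0 : 0 ≤ lam) (h1 : lam < 2 * eps1 L) :
    aKer L lam (ex L) - aKer L 0 (ex L) = lam * Gres L lam 0 / 4 := by
  have hL2 : (0 : ℝ) < 2 * eps1 L := by linarith
  have ha := kernelAxisValue_holds L lam h0 h1
  have hb := kernelAxisValue_holds L 0 le_rfl hL2
  have e : ex L = (((1 : ZMod L)), (0 : ZMod L)) := rfl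
  rw [e, ha, hb]
  ring

/-- ★ THE SOURCED RECURSION: `Σ_e ℓ(r+e) = (4 − λ)ℓ(r) + λ(G̃_λ(0) − a₀(r))` for every `r` (`0 ≤ λ < 2ε₁`). [folklore] -/
theorem lamPart_nbSum {lam : ℝ} (h0 : 0 ≤ lam) (h1 : lam < 2 * eps1 L) (r : Tor L) :
    nbSum L (fun s => aKer L lam s - aKer L 0 s) r
      = (4 - lam) * (aKer L lam r - aKer L 0 r) + lam * (Gres L lam 0 - aKer L 0 r) := by
  have hL2 : (0 : ℝ) < 2 * eps1 L := by linarith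
  have ha := kernelHarmonicity_holds L lam h0 h1 r
  have hb := kernelHarmonicity_holds L 0 le_rfl hL2 r
  rw [nnList_map_sum] at ha hb
  unfold nbSum
  linarith

/-- integer-coordinate form: `ℓ(x+1,y) + ℓ(x−1,y) + ℓ(x,y+1) + ℓ(x,y−1) = (4 − λ)ℓ(x,y) + λ(G̃_λ(0) − a₀(x,y))`. [folklore] -/
theorem lamPart_identity {lam : ℝ} (h0 : 0 ≤ lam) (h1 : lam < 2 * eps1 L) (x y : ℤ) :
    (aKer L lam ((((x + 1 : ℤ)) : ZMod L), ((y : ℤ) : ZMod L)) - aKer L 0 ((((x + 1 : ℤ)) : ZMod L), ((y : ℤ) : ZMod L)))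
      + (aKer L lam ((((x - 1 : ℤ)) : ZMod L), ((y : ℤ) : ZMod L)) - aKer L 0 ((((x - 1 : ℤ)) : ZMod L), ((y : ℤ) : ZMod L)))
      + (aKer L lam (((x : ℤ) : ZMod L), (((y + 1 : ℤ)) : ZMod L)) - aKer L 0 (((x : ℤ) : ZMod L), (((y + 1 : ℤ)) : ZMod L)))
      + (aKer L lam (((x : ℤ) : ZMod L), (((y - 1 : ℤ)) : ZMod L)) - aKer L 0 (((x : ℤ) : ZMod L), (((y - 1 : ℤ)) : ZMod L)))
      = (4 - lam) * (aKer L lam (((x : ℤ) : ZMod L), ((y : ℤ) : ZMod L)) - aKer L 0 (((x : ℤ) : ZMod L), ((y : ℤ) : ZMod L)))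
        + lam * (Gres L lam 0 - aKer L 0 (((x : ℤ) : ZMod L), ((y : ℤ) : ZMod L))) := by
  have h := lamPart_nbSum L h0 h1 ((((x : ℤ) : ZMod L), ((y : ℤ) : ZMod L)) : Tor L)
  unfold nbSum at h
  have e1 : ((((x : ℤ) : ZMod L), ((y : ℤ) : ZMod L)) : Tor L) + ex L = ((((x + 1 : ℤ)) : ZMod L), ((y : ℤ) : ZMod L)) := by
    ext <;> simp [ex]
  have e2 : ((((x : ℤ) : ZMod L), ((y : ℤ) : ZMod L)) : Tor L) + -ex L = ((((x - 1 : ℤ)) : ZMod L), ((y : ℤ) : ZMod L)) := by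
    ext <;> simp [ex, sub_eq_add_neg]
  have e3 : ((((x : ℤ) : ZMod L), ((y : ℤ) : ZMod L)) : Tor L) + ey L = (((x : ℤ) : ZMod L), (((y + 1 : ℤ)) : ZMod L)) := by
    ext <;> simp [ey]
  have e4 : ((((x : ℤ) : ZMod L), ((y : ℤ) : ZMod L)) : Tor L) + -ey L = (((x : ℤ) : ZMod L), (((y - 1 : ℤ)) : ZMod L)) := by
    ext <;> simp [ey, sub_eq_add_neg]
  rw [e1, e2, e3, e4] at h
  exact h

/-! ## Symmetries and solved forms -/

/-- swap symmetry of the λ-part. [folklore] -/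
theorem lamPart_swap (lam : ℝ) (x y : ℤ) :
    aKer L lam (((y : ℤ) : ZMod L), ((x : ℤ) : ZMod L)) - aKer L 0 (((y : ℤ) : ZMod L), ((x : ℤ) : ZMod L))
      = aKer L lam (((x : ℤ) : ZMod L), ((y : ℤ) : ZMod L)) - aKer L 0 (((x : ℤ) : ZMod L), ((y : ℤ) : ZMod L)) := by
  rw [aKer_int_swap L lam x y, aKer_int_swap L 0 x y]

/-- mirror symmetry of the λ-part. [folklore] -/
theorem lamPart_mirror_y (lam : ℝ) (x y : ℤ) :
    aKer L lam (((x : ℤ) : ZMod L), (((-y : ℤ)) : ZMod L)) - aKer L 0 (((x : ℤ) : ZMod L), (((-y : ℤ)) : ZMod L))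
      = aKer L lam (((x : ℤ) : ZMod L), ((y : ℤ) : ZMod L)) - aKer L 0 (((x : ℤ) : ZMod L), ((y : ℤ) : ZMod L)) := by
  rw [aKer_int_mirror_y L lam x y, aKer_int_mirror_y L 0 x y]

/-- ★ ROW STEP (solved form, neighbour coordinates explicit for literal instantiation):
`ℓ(x+1,y) = (4−λ)ℓ(x,y) + λ(G̃_λ(0) − a₀(x,y)) − ℓ(x−1,y) − ℓ(x,y+1) − ℓ(x,y−1)`. [folklore] -/
theorem lamPart_next {lam : ℝ} (h0 : 0 ≤ lam) (h1 : lam < 2 * eps1 L) (x y xp xm yp ym : ℤ) (hxp : xp = x + 1)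
    (hxm : xm = x - 1) (hyp : yp = y + 1) (hym : ym = y - 1) :
    aKer L lam (((xp : ℤ) : ZMod L), ((y : ℤ) : ZMod L)) - aKer L 0 (((xp : ℤ) : ZMod L), ((y : ℤ) : ZMod L))
      = (4 - lam) * (aKer L lam (((x : ℤ) : ZMod L), ((y : ℤ) : ZMod L)) - aKer L 0 (((x : ℤ) : ZMod L), ((y : ℤ) : ZMod L)))
        + lam * (Gres L lam 0 - aKer L 0 (((x : ℤ) : ZMod L), ((y : ℤ) : ZMod L)))
        - (aKer L lam (((xm : ℤ) : ZMod L), ((y : ℤ) : ZMod L)) - aKer L 0 (((xm : ℤ) : ZMod L), ((y : ℤ) : ZMod L)))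
        - (aKer L lam (((x : ℤ) : ZMod L), ((yp : ℤ) : ZMod L)) - aKer L 0 (((x : ℤ) : ZMod L), ((yp : ℤ) : ZMod L)))
        - (aKer L lam (((x : ℤ) : ZMod L), ((ym : ℤ) : ZMod L)) - aKer L 0 (((x : ℤ) : ZMod L), ((ym : ℤ) : ZMod L))) := by
  subst hxp hxm hyp hym
  have h := lamPart_identity L h0 h1 x y
  linarith

/-- ★ DIAGONAL-NEIGHBOUR STEP: `2ℓ(n+1,n) = (4−λ)ℓ(n,n) + λ(G̃_λ(0) − a₀(n,n)) − 2ℓ(n,n−1)` (swap symmetry). [folklore] -/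
theorem lamPart_diag_next {lam : ℝ} (h0 : 0 ≤ lam) (h1 : lam < 2 * eps1 L) (n np nm : ℤ) (hnp : np = n + 1)
    (hnm : nm = n - 1) :
    2 * (aKer L lam (((np : ℤ) : ZMod L), ((n : ℤ) : ZMod L)) - aKer L 0 (((np : ℤ) : ZMod L), ((n : ℤ) : ZMod L)))
      = (4 - lam) * (aKer L lam (((n : ℤ) : ZMod L), ((n : ℤ) : ZMod L)) - aKer L 0 (((n : ℤ) : ZMod L), ((n : ℤ) : ZMod L)))
        + lam * (Gres L lam 0 - aKer L 0 (((n : ℤ) : ZMod L), ((n : ℤ) : ZMod L)))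
        - 2 * (aKer L lam (((n : ℤ) : ZMod L), ((nm : ℤ) : ZMod L)) - aKer L 0 (((n : ℤ) : ZMod L), ((nm : ℤ) : ZMod L))) := by
  subst hnp hnm
  have h := lamPart_identity L h0 h1 n n
  rw [aKer_int_swap L lam (n + 1) n, aKer_int_swap L 0 (n + 1) n, aKer_int_swap L lam n (n - 1),
    aKer_int_swap L 0 n (n - 1)] at h
  linarith

/-! ## The first window entries from the diagonal λ-part and the capacity -/

/-- the λ-part vanishes at the origin. [folklore] -/
theorem lamPart_zero (lam : ℝ) :
    aKer L lam ((((0 : ℤ)) : ZMod L), (((0 : ℤ)) : ZMod L)) - aKer L 0 ((((0 : ℤ)) : ZMod L), (((0 : ℤ)) : ZMod L)) = 0 := by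
  have : (((((0 : ℤ)) : ZMod L), (((0 : ℤ)) : ZMod L)) : Tor L) = 0 := by push_cast; rfl
  rw [this]
  unfold aKer
  simp

/-- the λ-part at `(1,0)` in integer coordinates. [folklore] -/
theorem lamPart_one_zero {lam : ℝ} (h0 : 0 ≤ lam) (h1 : lam < 2 * eps1 L) :
    aKer L lam ((((1 : ℤ)) : ZMod L), (((0 : ℤ)) : ZMod L)) - aKer L 0 ((((1 : ℤ)) : ZMod L), (((0 : ℤ)) : ZMod L))
      = lam * Gres L lam 0 / 4 := by
  have e : (((((1 : ℤ)) : ZMod L), (((0 : ℤ)) : ZMod L)) : Tor L) = ex L := by push_cast; rfl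
  rw [e]; exact lamPart_axis L h0 h1

/-- ★ `ℓ(2,0) = (4−λ)·λG̃_λ(0)/4 + λ(G̃_λ(0) − (1 − 1/V)/4) − 2ℓ(1,1)` (`L ≥ 2`): the axis beyond `eₓ` from the diagonal value `ℓ(1,1)`. [folklore] -/
theorem lamPart_two_zero (hL : 2 ≤ L) {lam : ℝ} (h0 : 0 ≤ lam) (h1 : lam < 2 * eps1 L) :
    aKer L lam ((((2 : ℤ)) : ZMod L), (((0 : ℤ)) : ZMod L)) - aKer L 0 ((((2 : ℤ)) : ZMod L), (((0 : ℤ)) : ZMod L))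
      = (4 - lam) * (lam * Gres L lam 0 / 4) + lam * (Gres L lam 0 - (1 - 1 / (L : ℝ) ^ 2) / 4)
        - 2 * (aKer L lam ((((1 : ℤ)) : ZMod L), (((1 : ℤ)) : ZMod L)) - aKer L 0 ((((1 : ℤ)) : ZMod L), (((1 : ℤ)) : ZMod L))) := by
  have h := lamPart_next L h0 h1 1 0 2 0 1 (-1) (by norm_num) (by norm_num) (by norm_num) (by norm_num)
  have hm := lamPart_mirror_y L lam 1 1
  rw [show (-1 : ℤ) = -(1 : ℤ) from rfl] at h
  rw [hm, lamPart_one_zero L h0 h1, lamPart_zero] at h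
  have ha : aKer L 0 ((((1 : ℤ)) : ZMod L), (((0 : ℤ)) : ZMod L)) = (1 - 1 / (L : ℝ) ^ 2) / 4 := by
    have e : (((((1 : ℤ)) : ZMod L), (((0 : ℤ)) : ZMod L)) : Tor L) = ex L := by push_cast; rfl
    rw [e]; exact aKer_zero_axis L hL
  rw [ha] at h
  linarith

/-- ★ `2ℓ(2,1) = (4−λ)ℓ(1,1) + λ(G̃_λ(0) − a₀(1,1)) − λG̃_λ(0)/2`. [folklore] -/
theorem lamPart_two_one {lam : ℝ} (h0 : 0 ≤ lam) (h1 : lam < 2 * eps1 L) :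
    2 * (aKer L lam ((((2 : ℤ)) : ZMod L), (((1 : ℤ)) : ZMod L)) - aKer L 0 ((((2 : ℤ)) : ZMod L), (((1 : ℤ)) : ZMod L)))
      = (4 - lam) * (aKer L lam ((((1 : ℤ)) : ZMod L), (((1 : ℤ)) : ZMod L)) - aKer L 0 ((((1 : ℤ)) : ZMod L), (((1 : ℤ)) : ZMod L)))
        + lam * (Gres L lam 0 - aKer L 0 ((((1 : ℤ)) : ZMod L), (((1 : ℤ)) : ZMod L))) - lam * Gres L lam 0 / 2 := by
  have h := lamPart_diag_next L h0 h1 1 2 0 (by norm_num) (by norm_num)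
  have h10 : aKer L lam ((((1 : ℤ)) : ZMod L), (((0 : ℤ)) : ZMod L)) - aKer L 0 ((((1 : ℤ)) : ZMod L), (((0 : ℤ)) : ZMod L))
      = lam * Gres L lam 0 / 4 := lamPart_one_zero L h0 h1
  rw [h10] at h
  linarith

end Subsample

end Summit.HubbardSuperconductivity.HubbardSuperconductivity.Theorems.AnisotropyChord.Transfer.Fibre3

end
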